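import Mathlib.Topology.Algebra.OpenSubgroup
import Mathlib.Topology.Sequences
import Literature.AnabelianGeometry.SemiGraphs.SubgroupPresentationArithAction
import HarnessLib

/-!
# The arithmetic level kernels and their cofinality ([SemiAnbd] §5, Prop. 5.2 (iii)(iv) p. 64)

Mochizuki, *Semi-graphs of anabelioids*, Publ. RIMS **42** (2006), §5, Prop. 5.2 (iii)(iv) p. 64
("`B^temp(𝔊)` is a connected temperoid … natural exact sequences
`1 → Π^temp_𝒢 → Π^temp_𝔊 → Π_A → 1`") [cite: MochizukiSemiAnbd2006, Prop 5.2 (iv), p. 64].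

PURE GROUP THEORY + TOPOLOGY (cell row T54-B, tower third, file T1d = the LEVEL FAMILY handed to the
temperation engine `TemperedExtension.exists_isTempered_topology_of_kernelSeq` of abc-iut-L3-d2;
plan/GAP-LEDGER.md G-w4d053-1).  For a `Φ`-stable level `L ≤ Γ` the *arithmetic level kernel*
`levelKer L := ker (arithAct L) ⊓ ker σ ⊓ {e | ∀ y, Φ_e(y) y⁻¹ ∈ L} ≤ E` is normal, antitone in `L`,
and its preimage under the inner action `ι : Γ → E` contains `L` (hence is OPEN when `L` is) and is
contained in `L · H_{w₀}` (it fixes the vertex `H_{w₀} · 1 · L`).  COFINALITY: if ONE vertex subgroup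
`H_{w₀}` is compact, `Γ` is Hausdorff first countable with trivial centre, and the levels `L n` are
open, antitone and cofinal at `1`, then the preimages of the `levelKer (L n)` are cofinal at `1` — the
hypothesis `hK3` of the temperation engine, for edged AND one-vertex graphs alike.  Nothing here bears
on [IUTchIII] Cor. 3.12.
-/

namespace Literature.AnabelianGeometry.SemiGraphs

namespace SemiGraph

namespace SubgroupPresentation

open CategoryTheory Filter Topology

universe u v

variable {𝔾 : SemiGraph.{u}} {Γ : Type u} [Group Γ] {E : Type v} [Group E]
variable (P : SubgroupPresentation 𝔾 Γ) {Φ : E →* MulAut Γ} {σ : E →* Aut 𝔾}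

/-! ### Elements of `E` inner modulo a level -/

/-- The elements of `E` acting on `Γ` trivially MODULO the `Φ`-stable subgroup `L`:
`{e | ∀ y, Φ_e(y) y⁻¹ ∈ L}`. [cite: MochizukiSemiAnbd2006, Prop 5.2 (iv), p. 64] -/
def centralMod (Φ : E →* MulAut Γ) (L : Subgroup Γ) : Subgroup E where
  carrier := {e | ∀ y : Γ, Φ e y * y⁻¹ ∈ L}
  one_mem' y := by simp
  mul_mem' {e f} he hf y := by
    have : Φ (e * f) y * y⁻¹ = (Φ e (Φ f y) * (Φ f y)⁻¹) * (Φ f y * y⁻¹) := by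
      simp only [map_mul, MulAut.mul_apply]; group
    rw [this]
    exact mul_mem (he _) (hf y)
  inv_mem' {e} he y := by
    have h := he (Φ e⁻¹ y)
    have hy : Φ e (Φ e⁻¹ y) = y := by
      rw [← MulAut.mul_apply, ← map_mul, mul_inv_cancel, map_one, MulAut.one_apply]
    rw [hy] at h
    simpa using inv_mem h

/-- Membership in `centralMod`. [cite: MochizukiSemiAnbd2006, Prop 5.2 (iv), p. 64] -/
theorem mem_centralMod_iff {L : Subgroup Γ} {e : E} :
    e ∈ centralMod Φ L ↔ ∀ y : Γ, Φ e y * y⁻¹ ∈ L := Iff.rfl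

/-- `centralMod` is normal when the level is `Φ`-stable. [cite: MochizukiSemiAnbd2006, Prop 5.2 (iv), p. 64] -/
theorem centralMod_normal (L : Subgroup Γ) (hL : ∀ (e : E) (x : Γ), x ∈ L → Φ e x ∈ L) :
    (centralMod Φ L).Normal := by
  refine ⟨fun e he f y => ?_⟩
  have h := he (Φ f⁻¹ y)
  have hy : Φ f (Φ f⁻¹ y) = y := by
    rw [← MulAut.mul_apply, ← map_mul, mul_inv_cancel, map_one, MulAut.one_apply]
  have : Φ (f * e * f⁻¹) y * y⁻¹ = Φ f (Φ e (Φ f⁻¹ y) * (Φ f⁻¹ y)⁻¹) := by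
    rw [map_mul (Φ f), map_inv (Φ f), hy, map_mul Φ, map_mul Φ, MulAut.mul_apply, MulAut.mul_apply]
  rw [this]
  exact hL f _ h

/-- `centralMod` is monotone in the level. [cite: MochizukiSemiAnbd2006, Prop 5.2 (iv), p. 64] -/
theorem centralMod_mono {L L' : Subgroup Γ} (h : L ≤ L') : centralMod Φ L ≤ centralMod Φ L' :=
  fun _ he y => h (he y)

/-! ### The level kernels -/

section Level

variable (hP : P.IsArithCompatible Φ σ) (L : Subgroup Γ)
  (hL : ∀ (e : E) (x : Γ), x ∈ L → Φ e x ∈ L)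

/-- **The arithmetic level kernel** at the `Φ`-stable normal level `L`: the elements of `E` acting
trivially on the level-`L` coset semi-graph, trivially on `𝔾`, and trivially on `Γ` modulo `L`.
[cite: MochizukiSemiAnbd2006, Prop 5.2 (iv), p. 64] -/
noncomputable def levelKer : Subgroup E := (P.arithAct hP L hL).ker ⊓ σ.ker ⊓ centralMod Φ L

/-- Membership in the level kernel. [cite: MochizukiSemiAnbd2006, Prop 5.2 (iv), p. 64] -/
theorem mem_levelKer_iff {e : E} : e ∈ P.levelKer hP L hL ↔
    P.arithAct hP L hL e = 1 ∧ σ e = 1 ∧ ∀ y : Γ, Φ e y * y⁻¹ ∈ L := by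
  simp only [levelKer, Subgroup.mem_inf, MonoidHom.mem_ker, mem_centralMod_iff, and_assoc]

/-- The level kernel is normal. [cite: MochizukiSemiAnbd2006, Prop 5.2 (iv), p. 64] -/
theorem levelKer_normal : (P.levelKer hP L hL).Normal := by
  refine ⟨fun e he f => ?_⟩
  rw [mem_levelKer_iff] at he ⊢
  obtain ⟨h1, h2, h3⟩ := he
  refine ⟨by rw [map_mul, map_mul, h1, mul_one, map_inv, mul_inv_cancel],
    by rw [map_mul, map_mul, h2, mul_one, map_inv, mul_inv_cancel], ?_⟩
  exact (centralMod_normal (Φ := Φ) L hL).conj_mem e h3 f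

variable (ι : Γ →* E) (hιΦ : ∀ g : Γ, Φ (ι g) = MulAut.conj g) (hισ : ∀ g : Γ, σ (ι g) = 1)
include hιΦ hισ

/-- Along the inner action, the level kernel contains the level: `L ≤ ι⁻¹(levelKer L)`.
[cite: MochizukiSemiAnbd2006, Prop 5.2 (iv), p. 64] -/
theorem le_comap_levelKer [L.Normal] : L ≤ (P.levelKer hP L hL).comap ι := by
  intro g hg
  rw [Subgroup.mem_comap, mem_levelKer_iff]
  refine ⟨?_, hισ g, fun y => ?_⟩
  · rw [P.arithAct_eq_deckAct_of_inner hP L hL (hιΦ g) (hισ g)]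
    exact P.deckAct_eq_one_of_mem L hg
  · rw [hιΦ, MulAut.conj_apply]
    have := mul_mem hg (‹L.Normal›.conj_mem g⁻¹ (inv_mem hg) y)
    simpa [mul_assoc] using this

omit hισ in
/-- Along the inner action, the preimage of the level kernel lies in `L · H_{w₀}` for every vertex
`w₀` (it fixes the vertex `H_{w₀} 1 L`). [cite: MochizukiSemiAnbd2006, Prop 5.2 (iv), p. 64] -/
theorem exists_mem_level_mul_of_mem_comap_levelKer [L.Normal] (w₀ : 𝔾.Vertex) {g : Γ}
    (hg : g ∈ (P.levelKer hP L hL).comap ι) : ∃ c ∈ L, ∃ h ∈ P.H w₀, g = c * h := by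
  rw [Subgroup.mem_comap, mem_levelKer_iff] at hg
  obtain ⟨hact, hσ, -⟩ := hg
  have hfix := congrArg (fun f : Aut (P.cosetGraph L) => f.hom.vertexMap (P.vMk L w₀ 1)) hact
  have hk : P.IsVConj Φ σ (ι g) w₀ g := IsVConj.of_inner (hιΦ g) hσ w₀
  have hfix' : P.vMk L ((σ (ι g)).hom.vertexMap w₀) (g⁻¹ * Φ (ι g) 1) = P.vMk L w₀ 1 := by
    rw [← P.arithAct_vertexMap_vMk hP L hL hk]; exact hfix
  have hw : (σ (ι g)).hom.vertexMap w₀ = w₀ := by rw [hσ]; rfl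
  have hz : P.vMk L w₀ (g⁻¹ * Φ (ι g) 1) = P.vMk L w₀ 1 := by
    rw [← hfix']; exact (P.vMk_eq L hw rfl).symm
  have key : DoubleCoset.mk (P.H w₀) L g⁻¹ = DoubleCoset.mk (P.H w₀) L 1 := by
    have := eq_of_heq (Sigma.mk.inj_iff.mp hz).2
    simpa using this
  obtain ⟨h, hh, c, hc, hhc⟩ := (DoubleCoset.eq _ _ _ _).mp key
  -- `1 = h * g⁻¹ * c` ⇒ `g = c * h`
  refine ⟨c, hc, h, hh, ?_⟩
  have h1 : g⁻¹ = (c * h)⁻¹ := by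
    rw [mul_inv_rev]
    calc g⁻¹ = h⁻¹ * (h * g⁻¹ * c) * c⁻¹ := by group
      _ = h⁻¹ * c⁻¹ := by rw [← hhc]; group
  exact inv_injective h1

end Level

/-- The level kernels are ANTITONE in the level. [cite: MochizukiSemiAnbd2006, Prop 5.2 (iv), p. 64] -/
theorem levelKer_mono (hP : P.IsArithCompatible Φ σ) {L L' : Subgroup Γ}
    (hL : ∀ (e : E) (x : Γ), x ∈ L → Φ e x ∈ L) (hL' : ∀ (e : E) (x : Γ), x ∈ L' → Φ e x ∈ L')
    (h : L ≤ L') : P.levelKer hP L hL ≤ P.levelKer hP L' hL' := by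
  intro e he
  rw [mem_levelKer_iff] at he ⊢
  obtain ⟨hact, hσ, hc⟩ := he
  refine ⟨?_, hσ, fun y => h (hc y)⟩
  -- trivial at the finer level ⇒ trivial at the coarser level (transitions are surjective, equivariant)
  ext : 1
  have htr := P.arithAct_trans hP hL hL' h e
  rw [hact] at htr
  refine P.hom_ext_mk L' _ _ (fun w y => ?_) (fun ε y => ?_) (fun b y => ?_)
  · exact (congrArg (fun f : P.cosetGraph L ⟶ P.cosetGraph L' => f.vertexMap (P.vMk L w y)) htr).symm
  · exact (congrArg (fun f : P.cosetGraph L ⟶ P.cosetGraph L' => f.edgeMap (P.eMk L ε y)) htr).symm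
  · exact (congrArg (fun f : P.cosetGraph L ⟶ P.cosetGraph L' => f.branchMap (P.bMk L b y)) htr).symm

/-! ### Cofinality of the level kernels along the inner action -/

/-- **Cofinality (`hK3` of the temperation engine).**  Let `Γ` be a Hausdorff first-countable
topological group with trivial centre, `H_{w₀}` compact, `L n` open normal `Φ`-stable levels,
antitone and cofinal at `1`.  Then the preimages `ι⁻¹(levelKer (L n))` are cofinal at `1`.  Proof:
an element of `ι⁻¹(levelKer (L n))` lies in `L n · H_{w₀}`; a sequence of such elements outside a
fixed neighbourhood `U` has, by compactness of `H_{w₀}`, a subsequence converging to some `a`, which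
lies in every (closed) `ι⁻¹(levelKer (L m))`, hence commutes with `Γ` modulo `⋂ L m = 1`, hence
`a = 1` — contradicting `U`. [cite: MochizukiSemiAnbd2006, Prop 5.2 (iv), p. 64] -/
theorem comap_levelKer_cofinal [TopologicalSpace Γ] [IsTopologicalGroup Γ] [FirstCountableTopology Γ]
    [T2Space Γ] (hP : P.IsArithCompatible Φ σ) (w₀ : 𝔾.Vertex) (hcpt : IsCompact (P.H w₀ : Set Γ))
    (hZ : Subgroup.center Γ = ⊥) (L : ℕ → Subgroup Γ) (hLn : ∀ n, (L n).Normal)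
    (hLst : ∀ (n : ℕ) (e : E) (x : Γ), x ∈ L n → Φ e x ∈ L n) (hanti : Antitone L)
    (hopen : ∀ n, IsOpen (L n : Set Γ)) (hcof : ∀ U ∈ 𝓝 (1 : Γ), ∃ n, (L n : Set Γ) ⊆ U)
    (ι : Γ →* E) (hιΦ : ∀ g : Γ, Φ (ι g) = MulAut.conj g) (hισ : ∀ g : Γ, σ (ι g) = 1) :
    ∀ U ∈ 𝓝 (1 : Γ), ∃ n, ((P.levelKer hP (L n) (hLst n)).comap ι : Set Γ) ⊆ U := by
  -- the preimages, as open (hence closed) subgroups, antitone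
  set M : ℕ → Subgroup Γ := fun n => (P.levelKer hP (L n) (hLst n)).comap ι with hM
  have hLM : ∀ n, L n ≤ M n := fun n => by
    haveI := hLn n; exact P.le_comap_levelKer hP (L n) (hLst n) ι hιΦ hισ
  have hMopen : ∀ n, IsOpen (M n : Set Γ) := fun n => Subgroup.isOpen_mono (hLM n) (hopen n)
  have hManti : Antitone M := fun m n hmn =>
    Subgroup.comap_mono (P.levelKer_mono hP (hLst n) (hLst m) (hanti hmn))
  -- the levels tend to `1`
  have hLtend : ∀ c : ℕ → Γ, (∀ n, c n ∈ L n) → Tendsto c atTop (𝓝 1) := by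
    intro c hc
    rw [tendsto_atTop_nhds]
    intro U h1 hU
    obtain ⟨n₀, hn₀⟩ := hcof U (hU.mem_nhds h1)
    exact ⟨n₀, fun n hn => hn₀ (hanti hn (hc n))⟩
  -- `⋂ L n = 1`
  have hLone : ∀ z : Γ, (∀ n, z ∈ L n) → z = 1 := by
    intro z hz
    by_contra hne
    obtain ⟨n, hn⟩ := hcof _ (compl_singleton_mem_nhds (Ne.symm hne))
    exact hn (hz n) rfl
  intro U hU
  by_contra hcon
  have hcon' : ∀ n, ¬ ((M n : Set Γ) ⊆ U) := fun n hn => hcon ⟨n, hn⟩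
  -- a bad sequence
  choose g hg using fun n => Set.not_subset.mp (hcon' n)
  -- decompose `g n = c n * h n`, `c n ∈ L n`, `h n ∈ H w₀`
  have hdec : ∀ n, ∃ c ∈ L n, ∃ h ∈ P.H w₀, g n = c * h := fun n => by
    haveI := hLn n
    exact P.exists_mem_level_mul_of_mem_comap_levelKer hP (L n) (hLst n) ι hιΦ w₀ (hg n).1
  choose c hc h hh hgch using hdec
  -- a convergent subsequence of `h`
  obtain ⟨a, -, φ, hφ, hha⟩ := hcpt.tendsto_subseq hh
  -- `g ∘ φ → a`
  have hga : Tendsto (g ∘ φ) atTop (𝓝 a) := by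
    have hca : Tendsto (c ∘ φ) atTop (𝓝 1) := (hLtend c hc).comp hφ.tendsto_atTop
    have := hca.mul hha
    simp only [one_mul] at this
    refine this.congr fun i => ?_
    simp [hgch]
  -- `a ∈ M m` for every `m`
  have haM : ∀ m, a ∈ (M m : Set Γ) := by
    intro m
    refine (Subgroup.isClosed_of_isOpen _ (hMopen m)).mem_of_tendsto hga ?_
    rw [eventually_atTop]
    refine ⟨m, fun i hi => hManti (hi.trans (hφ.id_le i)) (hg (φ i)).1⟩
  -- `a` is central, hence trivial
  have ha1 : a = 1 := by
    have hcen : a ∈ Subgroup.center Γ := by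
      rw [Subgroup.mem_center_iff]
      intro y
      have hy : ∀ m, a * y * a⁻¹ * y⁻¹ ∈ L m := by
        intro m
        have := haM m
        rw [SetLike.mem_coe, hM, Subgroup.mem_comap, P.mem_levelKer_iff hP (L m) (hLst m)] at this
        simpa [hιΦ, mul_assoc] using this.2.2 y
      have := hLone _ hy
      calc y * a = (a * y * a⁻¹ * y⁻¹)⁻¹ * (a * y) := by group
        _ = a * y := by rw [this]; simp
    rw [hZ] at hcen
    exact hcen
  -- contradiction: `g (φ i) ∈ U` eventually
  rw [ha1] at hga
  have := hga.eventually (p := fun x => x ∈ U) hU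
  rw [eventually_atTop] at this
  obtain ⟨i, hi⟩ := this
  exact (hg (φ i)).2 (hi i le_rfl)

end SubgroupPresentation

end SemiGraph

end Literature.AnabelianGeometry.SemiGraphs
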